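import Literature.NumberTheory.LFunctions.ZetaCertifiedEvaluationFast
import Mathlib.NumberTheory.ZetaValues
import HarnessLib

/-!
# A ball-arithmetic certified evaluator of `ζ(s)` with cheap high-order Euler–Maclaurin ratios

Topic `Literature/NumberTheory/LFunctions`. A third drop-in evaluator next to `zetaBox`
(`ZetaCertifiedEvaluation.lean`) and `zetaBoxFast` (`ZetaCertifiedEvaluationFast.lean`), with the
SAME tables and the same enclosure statement, aimed at the `~3000`-digit evaluations of the
certificate of Best–Trudgian's `limsup M(x)x^{-1/2} ≥ 1.6383` (`MertensCertificateBT2.lean`), where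
the two remaining costs of `zetaBoxFast` are the interval products of the composite powers and of
the Bernoulli correction terms (four big products and two big divisions each, `MC.mul`), and — in
the TABLES — the exact Bernoulli numbers `B_{2k}`, `k ≤ ν`, whose quadratic-time array costs a
minute at `ν ≈ 2000`:

* all products of the main sum and of the correction terms are done in complex BALLS
  (`FBC` = two `FB` balls of `MultiPrecisionBall.lean`: one big product per real product, rounding
  by shifts), converted to an interval once at the end;
* the correction terms beyond the exact ratios of the tables (`k ≥ T.nu`) use the ENCLOSURE
  `c_{k+1}/c_k = -ζ(2k+2)/(4π² ζ(2k)) ∈ -(1/4π²)·[1 - 4/4^k, 1]` (`c_k = B_{2k}/(2k)!`, from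
  `ζ(2k) = (-1)^{k+1} 2^{2k-1} π^{2k} c_k`, Mathlib's `hasSum_zeta_nat`, and
  `1 ≤ ζ(2k+2) ≤ ζ(2k) ≤ 1 + 4/4^k`), so that the number of correction terms `P.nuT` is no longer
  tied to the size of the exact Bernoulli table `T.nu` (the relative error `4/4^k` is harmless once
  `2k` plus the bits already gained exceed the working precision).

## Main definitions and results (namespace `Literature.NumberTheory.LFunctions.ZetaNumerics`)

* `FB.ofMI`, `FBC` (complex balls: `mem/add/sub/mul/mulFB/divNat/ofMC/toMC/…` with inclusion lemmas;
  namespace `Literature.Analysis.ValidatedNumerics.NumericsMP`);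
* `zetaEven k = Σ_n n^{-2k}`, `emCoeff_eq_zetaEven`, `emCoeff_ratio`, `zetaEven_le`, `ratioI`, `mem_ratioI`;
* `BallParams`, `powTableBall`, `mainBall`, `termsBall`, `remRadiusN`, **`zetaBall`**,
  **`mem_zetaBall`** — `T.Valid → s ∈ sB → s ≠ 1 → zetaBall T P sB = some Z → ζ(s) ∈ Z`.

## References

* H. M. Edwards, *Riemann's Zeta Function* (1974), §6.4 (Euler–Maclaurin for `ζ`). [Edwards1974]
* R. P. Brent, P. Zimmermann, *Modern Computer Arithmetic* (2010), §3.1, §4.4. [BrentZimmermann2010]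
-/

open Finset Complex
open Literature.Analysis.ValidatedNumerics.NumericsMP Literature.NumberTheory.LFunctions

/-! ## Complex balls -/

namespace Literature.Analysis.ValidatedNumerics.NumericsMP

namespace FB

/-- The ball of an interval at scale `2^Q`: centre `⌊(lo+hi)/2⌋`, radius `⌊(hi-lo)/2⌋ + 2`. [folklore] -/
def ofMI (I : MI) : FB := ⟨(I.lo + I.hi) / 2, ((I.hi - I.lo) / 2 + 2).toNat⟩

/-- Product with an integer (exact). [folklore] -/
def mulInt (A : FB) (k : ℤ) : FB := ⟨A.c * k, A.r * k.natAbs⟩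

variable {Q : ℕ} {x : ℝ} {A : FB}

/-- [folklore] -/
theorem mem_ofMI {I : MI} (h : MI.mem (2 ^ Q) x I) : mem Q x (ofMI I) := by
  obtain ⟨h1, h2⟩ := h
  push_cast at h1 h2
  have hlohi : I.lo ≤ I.hi := by
    have : (I.lo : ℝ) ≤ I.hi := h1.trans h2
    exact_mod_cast this
  rw [mem_def]
  simp only [ofMI]
  have hc := int_fdiv_bounds (I.lo + I.hi) (b := 2) (by norm_num)
  have hr0 : 0 ≤ (I.hi - I.lo) / 2 + 2 := by omega
  have hr : ((((I.hi - I.lo) / 2 + 2).toNat : ℕ) : ℝ) = (((I.hi - I.lo) / 2 : ℤ) : ℝ) + 2 := by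
    have e := Int.toNat_of_nonneg hr0
    have : ((((I.hi - I.lo) / 2 + 2).toNat : ℕ) : ℤ) = (I.hi - I.lo) / 2 + 2 := e
    exact_mod_cast this
  have hd := int_fdiv_bounds (I.hi - I.lo) (b := 2) (by norm_num)
  rw [hr]
  push_cast at hc hd ⊢
  rw [abs_le]
  constructor <;> linarith [hc.1, hc.2, hd.1, hd.2]

/-- [folklore] -/
theorem mem_mulInt (hx : mem Q x A) (k : ℤ) : mem Q (x * k) (mulInt A k) := by
  rw [mem_def] at hx ⊢
  simp only [mulInt]
  push_cast
  rw [show x * k * 2 ^ Q - A.c * k = (x * 2 ^ Q - A.c) * k by ring, abs_mul]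
  rw [Nat.cast_natAbs, Int.cast_abs]
  exact mul_le_mul_of_nonneg_right hx (abs_nonneg _)

/-- Membership at `j = 0`: from scale `2^Q` balls to scale `2^Q` intervals. [folklore] -/
theorem mem_toMI_zero (hx : mem Q x A) : MI.mem (2 ^ Q) x (toMI 0 A) := by
  have := mem_toMI hx (j := 0) (Nat.zero_le Q)
  simpa using this

end FB

/-- A complex ball: two real balls at the same scale `2^Q`. [folklore] -/
structure FBC where
  /-- real part -/
  re : FB
  /-- imaginary part -/
  im : FB
  deriving Inhabited

namespace FBC

/-- `z ∈ B` at scale `2^Q`. [folklore] -/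
def mem (Q : ℕ) (z : ℂ) (B : FBC) : Prop := FB.mem Q z.re B.re ∧ FB.mem Q z.im B.im

/-- Zero. [folklore] -/
def zero : FBC := ⟨FB.exact 0, FB.exact 0⟩
/-- The integer `n` at scale `2^Q`. [folklore] -/
def ofInt (Q : ℕ) (n : ℤ) : FBC := ⟨FB.exact (n * 2 ^ Q), FB.exact 0⟩
/-- Sum. [folklore] -/
def add (A B : FBC) : FBC := ⟨A.re.add B.re, A.im.add B.im⟩
/-- Difference. [folklore] -/
def sub (A B : FBC) : FBC := ⟨A.re.sub B.re, A.im.sub B.im⟩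
/-- Product (four real ball products). [folklore] -/
def mul (Q : ℕ) (A B : FBC) : FBC :=
  ⟨(FB.mul Q A.re B.re).sub (FB.mul Q A.im B.im), (FB.mul Q A.re B.im).add (FB.mul Q A.im B.re)⟩
/-- Product with a real ball. [folklore] -/
def mulFB (Q : ℕ) (A : FBC) (b : FB) : FBC := ⟨FB.mul Q A.re b, FB.mul Q A.im b⟩
/-- Product with an integer (exact). [folklore] -/
def mulInt (A : FBC) (k : ℤ) : FBC := ⟨A.re.mulInt k, A.im.mulInt k⟩
/-- Division by a positive natural. [folklore] -/
def divNat (A : FBC) (d : ℕ) : FBC := ⟨A.re.divNat d, A.im.divNat d⟩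
/-- From an interval box at scale `2^Q`. [folklore] -/
def ofMC (A : MC) : FBC := ⟨FB.ofMI A.re, FB.ofMI A.im⟩
/-- To an interval box at scale `2^Q`. [folklore] -/
def toMC (A : FBC) : MC := ⟨A.re.toMI 0, A.im.toMI 0⟩

variable {Q : ℕ} {z w : ℂ} {A B : FBC}

/-- [folklore] -/
theorem mem_zero (Q : ℕ) : mem Q 0 zero := by
  constructor <;> simpa [zero] using FB.mem_exact Q 0
/-- [folklore] -/
theorem mem_ofInt (Q : ℕ) (n : ℤ) : mem Q (n : ℂ) (ofInt Q n) := by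
  constructor
  · have := FB.mem_exact Q (n * 2 ^ Q)
    have e : (((n * 2 ^ Q : ℤ)) : ℝ) / 2 ^ Q = n := by push_cast; field_simp
    rw [e] at this; simpa [ofInt] using this
  · simpa [ofInt] using FB.mem_exact Q 0
/-- [folklore] -/
theorem mem_add (hz : mem Q z A) (hw : mem Q w B) : mem Q (z + w) (add A B) :=
  ⟨by simpa [add] using FB.mem_add hz.1 hw.1, by simpa [add] using FB.mem_add hz.2 hw.2⟩
/-- [folklore] -/
theorem mem_sub (hz : mem Q z A) (hw : mem Q w B) : mem Q (z - w) (sub A B) :=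
  ⟨by simpa [sub] using FB.mem_sub hz.1 hw.1, by simpa [sub] using FB.mem_sub hz.2 hw.2⟩
/-- [folklore] -/
theorem mem_mul (hz : mem Q z A) (hw : mem Q w B) : mem Q (z * w) (mul Q A B) := by
  constructor
  · have := FB.mem_sub (FB.mem_mul hz.1 hw.1) (FB.mem_mul hz.2 hw.2)
    simpa [mul, Complex.mul_re] using this
  · have := FB.mem_add (FB.mem_mul hz.1 hw.2) (FB.mem_mul hz.2 hw.1)
    simpa [mul, Complex.mul_im] using this
/-- [folklore] -/
theorem mem_mulFB {x : ℝ} {b : FB} (hz : mem Q z A) (hx : FB.mem Q x b) : mem Q (z * x) (mulFB Q A b) := by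
  constructor
  · have := FB.mem_mul hz.1 hx; simpa [mulFB] using this
  · have := FB.mem_mul hz.2 hx; simpa [mulFB] using this
/-- [folklore] -/
theorem mem_mulInt (hz : mem Q z A) (k : ℤ) : mem Q (z * k) (mulInt A k) := by
  constructor
  · have := FB.mem_mulInt hz.1 k; simpa [mulInt] using this
  · have := FB.mem_mulInt hz.2 k; simpa [mulInt] using this
/-- [folklore] -/
theorem mem_divNat (hz : mem Q z A) {d : ℕ} (hd : 0 < d) : mem Q (z / d) (divNat A d) := by
  constructor
  · have := FB.mem_divNat hz.1 hd; simpa [divNat, Complex.div_natCast_re] using this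
  · have := FB.mem_divNat hz.2 hd; simpa [divNat, Complex.div_natCast_im] using this
/-- [folklore] -/
theorem mem_ofMC {M : MC} (hz : MC.mem (2 ^ Q) z M) : mem Q z (ofMC M) :=
  ⟨FB.mem_ofMI hz.1, FB.mem_ofMI hz.2⟩
/-- [folklore] -/
theorem mem_toMC (hz : mem Q z A) : MC.mem (2 ^ Q) z (toMC A) :=
  ⟨FB.mem_toMI_zero hz.1, FB.mem_toMI_zero hz.2⟩

end FBC

end Literature.Analysis.ValidatedNumerics.NumericsMP

namespace Literature.NumberTheory.LFunctions.ZetaNumerics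

/-! ## `ζ(2k)` and the ratios of the Euler–Maclaurin coefficients -/

/-- `ζ(2k) = Σ_{n} n^{-2k}` as a real number (`k ≥ 1`; the `n = 0` term is `0`). [folklore] -/
noncomputable def zetaEven (k : ℕ) : ℝ := ∑' n : ℕ, 1 / (n : ℝ) ^ (2 * k)

/-- [folklore] -/
lemma hasSum_zetaEven {k : ℕ} (hk : k ≠ 0) : HasSum (fun n : ℕ ↦ 1 / (n : ℝ) ^ (2 * k)) (zetaEven k) := by
  unfold zetaEven
  rw [(hasSum_zeta_nat hk).tsum_eq]
  exact hasSum_zeta_nat hk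

/-- `ζ(2k) = (-1)^{k+1} 2^{2k-1} π^{2k} c_k`, `c_k = B_{2k}/(2k)!`. [folklore] -/
lemma zetaEven_eq {k : ℕ} (hk : k ≠ 0) :
    zetaEven k = (-1 : ℝ) ^ (k + 1) * (2 : ℝ) ^ (2 * k - 1) * Real.pi ^ (2 * k) * (emCoeff k : ℝ) := by
  unfold zetaEven
  rw [(hasSum_zeta_nat hk).tsum_eq, emCoeff]
  push_cast
  ring

/-- `1 ≤ ζ(2k)`. [folklore] -/
lemma one_le_zetaEven {k : ℕ} (hk : k ≠ 0) : 1 ≤ zetaEven k := by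
  have h := hasSum_zetaEven hk
  have := sum_le_hasSum {1} (fun n _ ↦ by positivity) h
  simpa using this

/-- `ζ(2k+2) ≤ ζ(2k)`. [folklore] -/
lemma zetaEven_succ_le {k : ℕ} (hk : k ≠ 0) : zetaEven (k + 1) ≤ zetaEven k := by
  refine hasSum_le (fun n ↦ ?_) (hasSum_zetaEven (by omega : k + 1 ≠ 0)) (hasSum_zetaEven hk)
  rcases Nat.eq_zero_or_pos n with rfl | hn
  · simp
  · have hn1 : (1 : ℝ) ≤ n := by exact_mod_cast hn
    rw [show 2 * (k + 1) = 2 * k + 2 by ring, pow_add]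
    rw [div_le_div_iff_of_pos_left one_pos (by positivity) (by positivity)]
    have : (1 : ℝ) ≤ (n : ℝ) ^ 2 := one_le_pow₀ hn1
    nlinarith [pow_pos (show (0 : ℝ) < n by linarith) (2 * k)]

/-- `ζ(2k) ≤ 1 + 4/4^k`. [folklore] -/
lemma zetaEven_le {k : ℕ} (hk : k ≠ 0) : zetaEven k ≤ 1 + 4 / 4 ^ k := by
  have h := hasSum_zetaEven hk
  -- split off the terms `n = 0, 1`
  have h2 := (hasSum_nat_add_iff' 2).2 h
  simp only [Finset.sum_range_succ, Finset.sum_range_zero, zero_add, Nat.cast_zero, Nat.cast_one,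
    one_pow, div_one] at h2
  have hz : (0 : ℝ) ^ (2 * k) = 0 := zero_pow (by omega)
  rw [hz, div_zero, zero_add] at h2
  -- compare with the tail of `ζ(2)` scaled by `4/4^k`
  have g := hasSum_zeta_two
  have g2 := (hasSum_nat_add_iff' 2).2 g
  simp only [Finset.sum_range_succ, Finset.sum_range_zero, zero_add, Nat.cast_zero, Nat.cast_one,
    one_pow, div_one, ne_eq, OfNat.ofNat_ne_zero, not_false_eq_true, zero_pow, div_zero] at g2
  have g3 := g2.mul_left (4 / 4 ^ k)
  have hcmp : ∀ n : ℕ, 1 / ((n + 2 : ℕ) : ℝ) ^ (2 * k) ≤ 4 / 4 ^ k * (1 / ((n + 2 : ℕ) : ℝ) ^ 2) := by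
    intro n
    have hn2 : (2 : ℝ) ≤ (n + 2 : ℕ) := by push_cast; linarith [Nat.cast_nonneg (α := ℝ) n]
    have hpos : (0 : ℝ) < (n + 2 : ℕ) := by linarith
    obtain ⟨j, rfl⟩ : ∃ j, k = j + 1 := ⟨k - 1, by omega⟩
    set mR : ℝ := ((n + 2 : ℕ) : ℝ) with hmR
    have h4 : (4 : ℝ) ^ j ≤ mR ^ (2 * j) := by
      rw [pow_mul]
      exact pow_le_pow_left₀ (by norm_num) (by nlinarith) j
    have e4 : (4 : ℝ) ^ (j + 1) = 4 ^ j * 4 := pow_succ 4 j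
    rw [show 2 * (j + 1) = 2 * j + 2 by ring, pow_add, e4, div_le_iff₀ (by positivity)]
    have e5 : (4 : ℝ) / (4 ^ j * 4) * (1 / mR ^ 2) * (mR ^ (2 * j) * mR ^ 2) = mR ^ (2 * j) / 4 ^ j := by
      field_simp
    rw [e5, le_div_iff₀ (by positivity), one_mul]
    exact h4
  have := hasSum_le hcmp h2 g3
  have hpi : Real.pi ^ 2 / 6 - 1 ≤ 1 := by
    have := Real.pi_lt_d2; nlinarith [Real.pi_pos]
  have h4k : (0 : ℝ) ≤ 4 / 4 ^ k := by positivity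
  nlinarith [mul_le_mul_of_nonneg_left hpi h4k]

/-- `c_k = (-1)^{k+1} ζ(2k) / (2^{2k-1} π^{2k})`. [folklore] -/
lemma emCoeff_eq_zetaEven {k : ℕ} (hk : k ≠ 0) :
    (emCoeff k : ℝ) = (-1 : ℝ) ^ (k + 1) * zetaEven k / ((2 : ℝ) ^ (2 * k - 1) * Real.pi ^ (2 * k)) := by
  rw [zetaEven_eq hk]
  have hs : ((-1 : ℝ) ^ (k + 1)) * ((-1 : ℝ) ^ (k + 1)) = 1 := by
    rw [← pow_add, ← two_mul]; exact Even.neg_one_pow ⟨k + 1, by ring⟩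
  rw [eq_div_iff (by positivity)]
  calc (emCoeff k : ℝ) * (2 ^ (2 * k - 1) * Real.pi ^ (2 * k))
      = 1 * (2 ^ (2 * k - 1) * Real.pi ^ (2 * k)) * emCoeff k := by ring
    _ = ((-1 : ℝ) ^ (k + 1) * (-1) ^ (k + 1)) * (2 ^ (2 * k - 1) * Real.pi ^ (2 * k)) * emCoeff k := by rw [hs]
    _ = _ := by ring

/-- `c_k ≠ 0` (`k ≥ 1`). [folklore] -/
lemma emCoeff_ne_zero {k : ℕ} (hk : k ≠ 0) : (emCoeff k : ℝ) ≠ 0 := by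
  rw [emCoeff_eq_zetaEven hk]
  have h1 := one_le_zetaEven hk
  have : (-1 : ℝ) ^ (k + 1) ≠ 0 := pow_ne_zero _ (by norm_num)
  exact div_ne_zero (mul_ne_zero this (by linarith)) (by positivity)

/-- The ratio of consecutive coefficients: `c_{k+1} = c_k · (-ζ(2k+2)/(4π² ζ(2k)))`. [folklore] -/
lemma emCoeff_ratio {k : ℕ} (hk : k ≠ 0) :
    (emCoeff (k + 1) : ℝ) = emCoeff k * (-(zetaEven (k + 1) / (4 * Real.pi ^ 2 * zetaEven k))) := by
  rw [emCoeff_eq_zetaEven hk, emCoeff_eq_zetaEven (by omega : k + 1 ≠ 0)]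
  have hz : zetaEven k ≠ 0 := by have := one_le_zetaEven hk; linarith
  have hpi : Real.pi ≠ 0 := Real.pi_pos.ne'
  have e1 : (2 : ℝ) ^ (2 * (k + 1) - 1) = 2 ^ (2 * k - 1) * 4 := by
    rw [show 2 * (k + 1) - 1 = 2 * k - 1 + 2 by omega, pow_add]; norm_num
  have e2 : Real.pi ^ (2 * (k + 1)) = Real.pi ^ (2 * k) * Real.pi ^ 2 := by
    rw [show 2 * (k + 1) = 2 * k + 2 by ring, pow_add]
  have e3 : (-1 : ℝ) ^ (k + 1 + 1) = -(-1) ^ (k + 1) := by rw [pow_succ]; ring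
  rw [e1, e2, e3]
  field_simp

/-- The interval ratio `-(1/(4π²)) · [1 - 4/4^k, 1]` at scale `S`. [folklore] -/
def ratioI (S : ℕ) (piI : MI) (k : ℕ) : Option MI :=
  match MI.divPos S (MI.ofInt S 1) ((MI.mul S piI piI).mulInt 4) with
  | none => none
  | some q =>
    let J : MI := ⟨(S : ℤ) - Literature.Analysis.ValidatedNumerics.Numerics.cdiv (4 * (S : ℤ)) (4 ^ k), S⟩
    some ((MI.mul S q J).neg)

/-- Soundness of `ratioI`: it contains `-ζ(2k+2)/(4π² ζ(2k))` (`k ≥ 1`). [folklore] -/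
theorem mem_ratioI {S : ℕ} (hS : 0 < S) {piI : MI} (hpi : MI.mem S Real.pi piI) {k : ℕ} (hk : k ≠ 0)
    {R : MI} (h : ratioI S piI k = some R) :
    MI.mem S (-(zetaEven (k + 1) / (4 * Real.pi ^ 2 * zetaEven k))) R := by
  unfold ratioI at h
  split at h
  · simp at h
  · rename_i q hq
    simp only [Option.some.injEq] at h
    subst h
    have hSr : (0 : ℝ) < S := by exact_mod_cast hS
    have h4 : MI.mem S (4 * Real.pi ^ 2) ((MI.mul S piI piI).mulInt 4) := by
      have := MI.mem_mulInt (MI.mem_mul hS hpi hpi) 4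
      convert this using 1; push_cast; ring
    have hqm : MI.mem S (1 / (4 * Real.pi ^ 2)) q := by
      have := MI.mem_divPos hS hq (MI.mem_ofInt S 1) h4
      simpa using this
    -- the ratio `ζ(2k+2)/ζ(2k) ∈ [1 - 4/4^k, 1]`
    have hz1 := one_le_zetaEven hk
    have hz1' := one_le_zetaEven (by omega : k + 1 ≠ 0)
    have hzle := zetaEven_succ_le hk
    have hzup := zetaEven_le hk
    have hz0 : 0 < zetaEven k := by linarith
    set ρ : ℝ := zetaEven (k + 1) / zetaEven k with hρ
    have hρ1 : ρ ≤ 1 := by rw [hρ, div_le_one hz0]; exact hzle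
    have hρ0 : 1 - 4 / 4 ^ k ≤ ρ := by
      rw [hρ, le_div_iff₀ hz0]
      have h44 : (0 : ℝ) ≤ 4 / 4 ^ k := by positivity
      nlinarith
    have hJ : MI.mem S ρ ⟨(S : ℤ) - Literature.Analysis.ValidatedNumerics.Numerics.cdiv (4 * (S : ℤ)) (4 ^ k), S⟩ := by
      rw [MI.mem_def]
      push_cast
      constructor
      · have hc := Literature.Analysis.ValidatedNumerics.Numerics.div_le_cdiv (a := 4 * (S : ℤ)) (b := 4 ^ k) (by positivity)
        push_cast at hc
        have : (1 - 4 / 4 ^ k) * (S : ℝ) = S - 4 * S / 4 ^ k := by ring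
        nlinarith [mul_le_mul_of_nonneg_right hρ0 hSr.le]
      · nlinarith
    have := MI.mem_neg (MI.mem_mul hS hqm hJ)
    convert this using 1
    rw [hρ]; field_simp

/-! ## The evaluator -/

/-- Parameters of the ball evaluator: scale `2^sb`; `expIFast` parameters; the total number of
Euler–Maclaurin correction terms `nuT` (`≥ 1`; terms beyond the exact ratios of the tables use
`ratioI`). [folklore] -/
structure BallParams where
  /-- bits of the scale -/
  sb : ℕ
  /-- guard bits (`expIFast`) -/
  guard : ℕ
  /-- angle doublings (`expIFast`) -/
  k : ℕ
  /-- Taylor block length (`expIFast`) -/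
  m : ℕ
  /-- Taylor blocks (`expIFast`) -/
  I : ℕ
  /-- total number of correction terms -/
  nuT : ℕ

variable (T : Tables) (P : BallParams) (sB : MC)

/-- A fresh power `n^{-s}` as a ball (from `cpowFreshFast`). [folklore] -/
def cpowBall (n : ℕ) : Option FBC :=
  (cpowFreshFast T ⟨P.sb, P.guard, P.k, P.m, P.I⟩ sB n).map FBC.ofMC

/-- One new entry of the ball power table. [folklore] -/
def powEntryBall (A : Array FBC) (m : ℕ) : Option FBC :=
  if m = 1 then some (FBC.ofInt P.sb 1)
  else if m.minFac = m then cpowBall T P sB m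
  else
    match A[m.minFac]?, A[m / m.minFac]? with
    | some x, some y => some (FBC.mul P.sb x y)
    | _, _ => none

/-- The ball table `[junk, 1^{-s}, …, n^{-s}]`. [folklore] -/
def powTableBall : ℕ → Option (Array FBC)
  | 0 => some #[FBC.zero]
  | m + 1 =>
    match powTableBall m with
    | none => none
    | some A =>
      match powEntryBall T P sB A (m + 1) with
      | none => none
      | some b => some (A.push b)

/-- `acc + Σ_{j=1}^{n} A[j]`. [folklore] -/
def sumPowB (A : Array FBC) : ℕ → FBC → FBC
  | 0, acc => acc
  | n + 1, acc => sumPowB A n (acc.add (A.getD (n + 1) default))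

/-- The Euler–Maclaurin main part `Σ_{n<N} n^{-s} + N · N^{-s}/(s-1) + ½ N^{-s}` in balls (the one
division done on intervals). [folklore] -/
def mainBall (A : Array FBC) : Option FBC :=
  let PN := A.getD T.N default
  match MC.divBox T.S ((FBC.toMC PN).mulInt T.N) (sB.sub (MC.ofInt T.S 1)) with
  | some q => some (((sumPowB A (T.N - 1) FBC.zero).add (FBC.ofMC q)).add (PN.divNat 2))
  | none => none

/-- The ratio `c_{k+1}/c_k` as a ball: exact from the tables for `k < T.nu`, else `ratioI`. [folklore] -/
def ratioB (k : ℕ) : Option FB :=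
  if k < T.nu then
    let r := T.ratios.getD (k - 1) 0
    some (FB.ofMI (MI.ofFrac T.S r.num r.den))
  else (ratioI T.S T.piI k).map FB.ofMI

/-- The factor `(s+2k-1)(s+2k)` as a ball. [folklore] -/
def factorB (k : ℕ) : FBC :=
  let sF := FBC.ofMC sB
  FBC.mul P.sb (sF.add (FBC.ofInt P.sb (2 * k - 1))) (sF.add (FBC.ofInt P.sb (2 * k)))

/-- The loop of the correction terms: from `T_k ∈ tk`, add `T_k, …, T_{k+fuel}` to `acc`;
`T_{k+1} = T_k · r_k · (s+2k-1)(s+2k)/N²`. [folklore] -/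
def termsLoop : ℕ → ℕ → FBC → FBC → Option FBC
  | 0, _, tk, acc => some (acc.add tk)
  | fuel + 1, k, tk, acc =>
    match ratioB T k with
    | none => none
    | some r =>
      let tk' := ((FBC.mul P.sb (FBC.mulFB P.sb tk r) (factorB P sB k)).divNat T.N).divNat T.N
      termsLoop fuel (k + 1) tk' (acc.add tk)

/-- The correction terms `Σ_{k=1}^{nuT} T_k`, `T_1 = s N^{-s}/(12N)`. [folklore] -/
def termsBall (PN : FBC) : Option FBC :=
  let t1 := ((FBC.mul P.sb (FBC.ofMC sB) PN).divNat 12).divNat T.N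
  termsLoop T P sB (P.nuT - 1) 1 t1 FBC.zero

/-- The remainder radius for `ν` correction terms (scaled by `S`). [folklore] -/
def remRadiusN (ν : ℕ) : ℤ :=
  Literature.Analysis.ValidatedNumerics.Numerics.cdiv (pochBound T sB (2 * ν + 1) * 33 * 25 ^ (2 * ν + 1))
    (10 * 157 ^ (2 * ν + 1) * (T.N : ℤ) ^ (2 * ν) * (2 * ν))

/-- **The ball evaluator**: a box containing `ζ(s)` for all `s` in `sB` (requires `0 < lo (re sB)`,
`T.S = 2^sb`, `1 ≤ nuT`; soundness `mem_zetaBall` additionally needs `s ≠ 1`). [folklore] -/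
def zetaBall : Option MC :=
  if 0 < sB.re.lo ∧ T.S = 2 ^ P.sb ∧ 0 < P.nuT then
    match powTableBall T P sB T.N with
    | none => none
    | some A =>
      match mainBall T sB A, termsBall T P sB (A.getD T.N default) with
      | some M, some Tm => some ((FBC.toMC (M.add Tm)).widen (remRadiusN T sB P.nuT))
      | _, _ => none
  else none

/-! ## Soundness -/

section Soundness

variable {T} {P} {sB} {s : ℂ}

/-- Soundness of `cpowBall`. [folklore] -/
theorem mem_cpowBall (hT : T.Valid) (hS2 : T.S = 2 ^ P.sb) (hs : MC.mem T.S s sB) {n : ℕ}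
    (hn1 : 1 ≤ n) (hnN : n ≤ T.N) {B : FBC} (h : cpowBall T P sB n = some B) :
    FBC.mem P.sb ((n : ℂ) ^ (-s)) B := by
  unfold cpowBall at h
  generalize hc : cpowFreshFast T ⟨P.sb, P.guard, P.k, P.m, P.I⟩ sB n = oc at h
  rcases oc with _ | C
  · simp at h
  · simp only [Option.map_some, Option.some.injEq] at h
    subst h
    have := mem_cpowFreshFast hT (P := ⟨P.sb, P.guard, P.k, P.m, P.I⟩) hS2 hs hn1 hnN hc
    rw [hS2] at this
    exact FBC.mem_ofMC this

/-- Soundness of the ball power table. [folklore] -/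
theorem powTableBall_spec (hT : T.Valid) (hS2 : T.S = 2 ^ P.sb) (hs : MC.mem T.S s sB) :
    ∀ (m : ℕ) {A : Array FBC}, m ≤ T.N → powTableBall T P sB m = some A →
      A.size = m + 1 ∧ ∀ n : ℕ, 1 ≤ n → n ≤ m → FBC.mem P.sb ((n : ℂ) ^ (-s)) (A.getD n default)
  | 0, A, _, h => by
    simp only [powTableBall, Option.some.injEq] at h
    subst h
    exact ⟨rfl, fun n h1 h2 ↦ by omega⟩
  | m + 1, A, hm, h => by
    simp only [powTableBall] at h
    split at h
    · simp at h
    · rename_i A0 hA0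
      split at h
      · simp at h
      · rename_i b hb
        simp only [Option.some.injEq] at h
        subst h
        obtain ⟨hsz, hmem⟩ := powTableBall_spec hT hS2 hs m (by omega) hA0
        refine ⟨by simp [hsz], fun n h1 h2 ↦ ?_⟩
        rcases Nat.lt_succ_iff_lt_or_eq.1 (Nat.lt_succ_of_le h2) with hlt | heq
        · have hlt' : n < A0.size := by rw [hsz]; omega
          have := hmem n h1 (Nat.lt_succ_iff.1 hlt)
          rw [Array.getD_eq_getD_getElem?, Array.getElem?_push_lt hlt', Option.getD_some]
          rw [Array.getD_eq_getD_getElem?, getElem?_pos A0 n hlt', Option.getD_some] at this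
          exact this
        · subst heq
          have hidx : (A0.push b)[m + 1]? = some b := by
            rw [← hsz]; exact Array.getElem?_push_size
          rw [Array.getD_eq_getD_getElem?, hidx, Option.getD_some]
          unfold powEntryBall at hb
          split_ifs at hb with h1' hp
          · simp only [Option.some.injEq] at hb
            subst hb
            rw [h1']
            simpa using FBC.mem_ofInt P.sb 1
          · exact mem_cpowBall hT hS2 hs h1 hm hb
          · split at hb
            · rename_i x y hx hy
              simp only [Option.some.injEq] at hb
              subst hb
              set p := (m + 1).minFac with hpdef
              have hpd : p ∣ m + 1 := Nat.minFac_dvd _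
              have hpr : p.Prime := Nat.minFac_prime h1'
              have hp2 : 2 ≤ p := hpr.two_le
              have hple : p ≤ m + 1 := Nat.minFac_le (by omega)
              have hplt : p < m + 1 := lt_of_le_of_ne hple hp
              have hq1 : 1 ≤ (m + 1) / p := by
                rw [Nat.one_le_div_iff (by omega)]; exact hple
              have hqlt : (m + 1) / p < m + 1 := Nat.div_lt_self (by omega) (by omega)
              have hxm : FBC.mem P.sb ((p : ℂ) ^ (-s)) x := by
                have := hmem p (by omega) (by omega)
                rwa [Array.getD_eq_getD_getElem?, hx, Option.getD_some] at this
              have hym : FBC.mem P.sb ((((m + 1) / p : ℕ) : ℂ) ^ (-s)) y := by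
                have := hmem ((m + 1) / p) hq1 (by omega)
                rwa [Array.getD_eq_getD_getElem?, hy, Option.getD_some] at this
              have key : (((m + 1 : ℕ) : ℂ)) ^ (-s) = (p : ℂ) ^ (-s) * (((m + 1) / p : ℕ) : ℂ) ^ (-s) := by
                rw [← natCast_mul_natCast_cpow, ← Nat.cast_mul, Nat.mul_div_cancel' hpd]
              rw [key]
              exact FBC.mem_mul hxm hym
            · simp at hb

/-- Soundness of `sumPowB`. [folklore] -/
lemma sumPowB_spec {A : Array FBC} {M : ℕ}
    (hA : ∀ n : ℕ, 1 ≤ n → n ≤ M → FBC.mem P.sb ((n : ℂ) ^ (-s)) (A.getD n default)) :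
    ∀ (n : ℕ) {acc : FBC} {a : ℂ}, n ≤ M → FBC.mem P.sb a acc →
      FBC.mem P.sb (a + ∑ j ∈ Finset.Ico 1 (n + 1), (j : ℂ) ^ (-s)) (sumPowB A n acc)
  | 0, acc, a, _, h => by simpa [sumPowB] using h
  | n + 1, acc, a, hn, h => by
    simp only [sumPowB]
    have h' := FBC.mem_add h (hA (n + 1) (by omega) hn)
    have := sumPowB_spec hA n (by omega) h'
    convert this using 1
    rw [Finset.sum_Ico_succ_top (by omega)]
    ring

/-- Soundness of `mainBall`. [folklore] -/
theorem mem_mainBall (hT : T.Valid) (hS2 : T.S = 2 ^ P.sb) (hs : MC.mem T.S s sB) {A : Array FBC}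
    (hA : ∀ n : ℕ, 1 ≤ n → n ≤ T.N → FBC.mem P.sb ((n : ℂ) ^ (-s)) (A.getD n default))
    {M : FBC} (h : mainBall T sB A = some M) : FBC.mem P.sb (emMainZero T.N s) M := by
  unfold mainBall at h
  simp only at h
  split at h
  · rename_i q hq
    simp only [Option.some.injEq] at h
    subst h
    have hN1 : 1 ≤ T.N := le_trans (by norm_num) hT.two_le_N
    have hPN := hA T.N hN1 le_rfl
    have hsum := sumPowB_spec (P := P) (M := T.N - 1) (fun n h1 h2 ↦ hA n h1 (by omega)) (T.N - 1)
      le_rfl (FBC.mem_zero P.sb)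
    simp only [zero_add, Nat.sub_add_cancel hN1] at hsum
    have hq' : FBC.mem P.sb ((T.N : ℂ) ^ (1 - s) / (s - 1)) (FBC.ofMC q) := by
      have hPN' : MC.mem T.S ((T.N : ℂ) ^ (-s)) (FBC.toMC (A.getD T.N default)) := by
        rw [hS2]; exact FBC.mem_toMC hPN
      have h1 := MC.mem_divBox hT.S_pos hq (MC.mem_mulInt hPN' (T.N : ℤ))
        (MC.mem_sub hs (MC.mem_ofInt T.S 1))
      rw [hS2] at h1
      have h2 := FBC.mem_ofMC h1
      convert h2 using 1
      have hN0 : (T.N : ℂ) ≠ 0 := by exact_mod_cast (show T.N ≠ 0 by omega)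
      rw [sub_eq_add_neg, cpow_add _ _ hN0, cpow_one]
      push_cast
      ring
    have hhalf : FBC.mem P.sb ((T.N : ℂ) ^ (-s) / 2) ((A.getD T.N default).divNat 2) := by
      have := FBC.mem_divNat hPN (d := 2) (by norm_num)
      simpa using this
    unfold emMainZero
    simpa [add_assoc] using FBC.mem_add (FBC.mem_add hsum hq') hhalf
  · simp at h

/-- The recursion of the correction terms with a REAL ratio:
`T_{k+1} = T_k · ρ · (s+2k-1)(s+2k)/N²` whenever `c_{k+1} = c_k ρ`. [folklore] -/
lemma emTerm_succ_real {N : ℕ} (hN : N ≠ 0) (s : ℂ) (k : ℕ) (hk : 1 ≤ k) (ρ : ℝ)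
    (hr : (emCoeff (k + 1) : ℝ) = emCoeff k * ρ) :
    emTerm N s (k + 1) =
      emTerm N s k * (ρ : ℂ) * ((s + ((2 * k - 1 : ℕ) : ℂ)) * (s + ((2 * k : ℕ) : ℂ))) / N / N := by
  have hc : ∀ j, ((bernoulli (2 * j) : ℚ) : ℂ) / (2 * j).factorial = (((emCoeff j : ℚ) : ℝ) : ℂ) := by
    intro j
    rw [emCoeff]
    push_cast
    rfl
  have hr' : (((emCoeff (k + 1) : ℚ) : ℝ) : ℂ) = (((emCoeff k : ℚ) : ℝ) : ℂ) * (ρ : ℂ) := by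
    rw [hr]; push_cast; ring
  unfold emTerm
  rw [hc, hc, hr']
  have e1 : 2 * (k + 1) - 1 = 2 * k - 1 + 1 + 1 := by omega
  rw [e1, emPoch_succ, emPoch_succ]
  have hN0 : (N : ℂ) ≠ 0 := by exact_mod_cast hN
  have hX : (N : ℂ) ^ (-(s + ((2 * k - 1 + 1 + 1 : ℕ) : ℂ))) =
      (N : ℂ) ^ (-(s + ((2 * k - 1 : ℕ) : ℂ))) / N / N := by
    rw [div_div, ← pow_two, ← cpow_natCast, ← cpow_sub _ _ hN0]
    congr 1
    push_cast
    ring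
  rw [hX]
  have e2 : ((2 * k - 1 + 1 : ℕ) : ℂ) = ((2 * k : ℕ) : ℂ) := by
    norm_cast; omega
  push_cast [e2]
  ring

/-- The ratios, exact or enclosed: for `1 ≤ k`, `ratioB k ∋ ρ_k` with `c_{k+1} = c_k ρ_k`. [folklore] -/
lemma ratioB_spec (hT : T.Valid) (hS2 : T.S = 2 ^ P.sb) {k : ℕ} (hk : 1 ≤ k) {r : FB}
    (h : ratioB T k = some r) : ∃ ρ : ℝ, FB.mem P.sb ρ r ∧ (emCoeff (k + 1) : ℝ) = emCoeff k * ρ := by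
  unfold ratioB at h
  split_ifs at h with hlt
  · simp only [Option.some.injEq] at h
    subst h
    obtain ⟨hlen, hrat⟩ := ratios_spec hT
    set q : ℚ := T.ratios.getD (k - 1) 0 with hq
    have hcoef : emCoeff (k + 1) = emCoeff k * q := by
      have := hrat (k - 1) (by omega)
      rw [show k - 1 + 2 = k + 1 by omega, show k - 1 + 1 = k by omega] at this
      exact this
    refine ⟨(q : ℝ), ?_, by exact_mod_cast hcoef⟩
    have hm : MI.mem T.S ((q : ℝ)) (MI.ofFrac T.S q.num q.den) := by
      have := MI.mem_ofFrac T.S q.num (q := q.den) q.den_pos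
      convert this using 1
      exact_mod_cast (Rat.num_div_den q).symm
    have hm' : MI.mem (2 ^ P.sb) ((q : ℝ)) (MI.ofFrac T.S q.num q.den) := by rw [← hS2]; exact hm
    exact FB.mem_ofMI hm'
  · generalize hR : ratioI T.S T.piI k = oR at h
    rcases oR with _ | R
    · simp at h
    · simp only [Option.map_some, Option.some.injEq] at h
      subst h
      have hk0 : k ≠ 0 := by omega
      refine ⟨_, ?_, emCoeff_ratio hk0⟩
      have hm := mem_ratioI hT.S_pos hT.mem_pi hk0 hR
      have hm' : MI.mem (2 ^ P.sb) (-(zetaEven (k + 1) / (4 * Real.pi ^ 2 * zetaEven k))) R := by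
        rw [← hS2]; exact hm
      exact FB.mem_ofMI hm'

/-- Soundness of `factorB`. [folklore] -/
lemma mem_factorB (hS2 : T.S = 2 ^ P.sb) (hs : MC.mem T.S s sB) (k : ℕ) (hk : 1 ≤ k) :
    FBC.mem P.sb ((s + ((2 * k - 1 : ℕ) : ℂ)) * (s + ((2 * k : ℕ) : ℂ))) (factorB P sB k) := by
  have hsF : FBC.mem P.sb s (FBC.ofMC sB) := FBC.mem_ofMC (hS2 ▸ hs)
  unfold factorB
  have ha := FBC.mem_add hsF (FBC.mem_ofInt P.sb (2 * (k : ℤ) - 1))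
  have hb := FBC.mem_add hsF (FBC.mem_ofInt P.sb (2 * (k : ℤ)))
  have := FBC.mem_mul ha hb
  have e : (((2 * (k : ℤ) - 1 : ℤ)) : ℂ) = ((2 * k - 1 : ℕ) : ℂ) := by
    rw [Nat.cast_sub (by omega)]; push_cast; ring
  have e' : (((2 * (k : ℤ) : ℤ)) : ℂ) = ((2 * k : ℕ) : ℂ) := by push_cast; ring
  rw [e, e'] at this
  exact this

/-- Soundness of `termsLoop`. [folklore] -/
lemma termsLoop_spec (hT : T.Valid) (hS2 : T.S = 2 ^ P.sb) (hs : MC.mem T.S s sB) :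
    ∀ (fuel k : ℕ) {tk acc : FBC} {a : ℂ}, 1 ≤ k →
      FBC.mem P.sb (emTerm T.N s k) tk → FBC.mem P.sb a acc →
      ∀ {R : FBC}, termsLoop T P sB fuel k tk acc = some R →
        FBC.mem P.sb (a + ∑ j ∈ Finset.Icc k (k + fuel), emTerm T.N s j) R
  | 0, k, tk, acc, a, hk, htk, hacc, R, h => by
    simp only [termsLoop, Option.some.injEq] at h
    subst h
    simp only [add_zero, Finset.Icc_self, Finset.sum_singleton]
    exact FBC.mem_add hacc htk
  | fuel + 1, k, tk, acc, a, hk, htk, hacc, R, h => by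
    simp only [termsLoop] at h
    split at h
    · simp at h
    · rename_i r hr
      have hN0 : T.N ≠ 0 := by have := hT.two_le_N; omega
      obtain ⟨ρ, hρ, hcoef⟩ := ratioB_spec hT hS2 hk hr
      have htk' : FBC.mem P.sb (emTerm T.N s (k + 1))
          (((FBC.mul P.sb (FBC.mulFB P.sb tk r) (factorB P sB k)).divNat T.N).divNat T.N) := by
        rw [emTerm_succ_real hN0 s k hk ρ hcoef]
        have h1 := FBC.mem_mulFB htk hρ
        have h2 := mem_factorB hS2 hs k hk
        have h3 := FBC.mem_mul h1 h2
        have h4 := FBC.mem_divNat (FBC.mem_divNat h3 (d := T.N) (by omega)) (d := T.N) (by omega)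
        exact h4
      have := termsLoop_spec hT hS2 hs fuel (k + 1) (by omega) htk' (FBC.mem_add hacc htk) h
      have hsplit : ∑ j ∈ Finset.Icc k (k + (fuel + 1)), emTerm T.N s j =
          emTerm T.N s k + ∑ j ∈ Finset.Icc (k + 1) (k + 1 + fuel), emTerm T.N s j := by
        have : Finset.Icc k (k + (fuel + 1)) = insert k (Finset.Icc (k + 1) (k + 1 + fuel)) := by
          ext j; simp; omega
        rw [this, Finset.sum_insert (by simp)]
      rw [hsplit, ← add_assoc]
      exact this

/-- Soundness of `termsBall`: it encloses `Σ_{j=1}^{nuT} T_j`. [folklore] -/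
theorem mem_termsBall (hT : T.Valid) (hS2 : T.S = 2 ^ P.sb) (hs : MC.mem T.S s sB) (hν : 0 < P.nuT)
    {PN : FBC} (hPN : FBC.mem P.sb ((T.N : ℂ) ^ (-s)) PN) {R : FBC} (h : termsBall T P sB PN = some R) :
    FBC.mem P.sb (∑ j ∈ Finset.Icc 1 P.nuT, emTerm T.N s j) R := by
  have hN1 : 1 ≤ T.N := le_trans (by norm_num) hT.two_le_N
  have hsF : FBC.mem P.sb s (FBC.ofMC sB) := FBC.mem_ofMC (hS2 ▸ hs)
  have ht1 : FBC.mem P.sb (emTerm T.N s 1) (((FBC.mul P.sb (FBC.ofMC sB) PN).divNat 12).divNat T.N) := by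
    have := FBC.mem_divNat (FBC.mem_divNat (FBC.mem_mul hsF hPN) (d := 12) (by norm_num)) (d := T.N) hN1
    convert this using 1
    unfold emTerm
    have hb2 : (bernoulli (2 * 1) : ℚ) = 1 / 6 := by
      rw [show 2 * 1 = 2 by rfl, bernoulli_eq_bernoulli'_of_ne_one (by norm_num), bernoulli'_two]
    rw [hb2]
    have hN0 : (T.N : ℂ) ≠ 0 := by exact_mod_cast (show T.N ≠ 0 by omega)
    simp only [show 2 * 1 - 1 = 1 by rfl, emPoch_one, show (2 * 1).factorial = 2 by rfl]
    rw [show -(s + ((1 : ℕ) : ℂ)) = -s - 1 by push_cast; ring, cpow_sub _ _ hN0, cpow_one]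
    push_cast
    field_simp
    ring
  unfold termsBall at h
  have := termsLoop_spec hT hS2 hs (P.nuT - 1) 1 le_rfl ht1 (FBC.mem_zero P.sb) h
  rw [show 1 + (P.nuT - 1) = P.nuT by omega, zero_add] at this
  exact this

/-- Soundness of the remainder radius for `ν` terms: `‖R_ν(s)‖ · S ≤ remRadiusN ν`. [folklore] -/
theorem norm_emRem_mul_le_remRadiusN (hT : T.Valid) (hs : MC.mem T.S s sB) (hσ : 0 < s.re) {ν : ℕ}
    (hν : ν ≠ 0) : ‖emRemHigher T.N ν s‖ * T.S ≤ (remRadiusN T sB ν : ℝ) := by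
  have hN1 : 1 ≤ T.N := le_trans (by norm_num) hT.two_le_N
  have hSr : (0 : ℝ) < T.S := by exact_mod_cast hT.S_pos
  have hR := norm_emRemHigher_le_rat hN1 hσ hν
  have hP := (norm_emPoch_le s (2 * ν + 1)).trans
    ((le_div_iff₀ hSr).2 (pochBound_spec hT hs (2 * ν + 1)))
  have hν0 : (0 : ℝ) < ν := by exact_mod_cast Nat.pos_of_ne_zero hν
  have hN0 : (0 : ℝ) < T.N := by exact_mod_cast hN1
  set U : ℤ := pochBound T sB (2 * ν + 1) with hU
  have hden : (0 : ℤ) < 10 * 157 ^ (2 * ν + 1) * (T.N : ℤ) ^ (2 * ν) * (2 * ν) := by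
    have : (0 : ℤ) < T.N := by exact_mod_cast hN1
    have : (0 : ℤ) < ν := by exact_mod_cast Nat.pos_of_ne_zero hν
    positivity
  have hc := Literature.Analysis.ValidatedNumerics.Numerics.div_le_cdiv (a := U * 33 * 25 ^ (2 * ν + 1)) hden
  unfold remRadiusN
  refine le_trans ?_ hc
  push_cast
  have hC : 0 ≤ (33 / 10 : ℝ) * (25 / 157) ^ (2 * ν + 1) := by positivity
  have hD : 0 ≤ 1 / ((T.N : ℝ) ^ (2 * ν) * (2 * ν)) := by positivity
  have hPS : ‖emPoch s (2 * ν + 1)‖ * T.S ≤ U := by rw [← le_div_iff₀ hSr]; exact hP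
  have h1 : ‖emRemHigher T.N ν s‖ * T.S ≤
      (U : ℝ) * ((33 / 10 : ℝ) * (25 / 157) ^ (2 * ν + 1)) * (1 / ((T.N : ℝ) ^ (2 * ν) * (2 * ν))) := by
    calc ‖emRemHigher T.N ν s‖ * T.S
        ≤ (‖emPoch s (2 * ν + 1)‖ * ((33 / 10 : ℝ) * (25 / 157) ^ (2 * ν + 1)) *
            (1 / ((T.N : ℝ) ^ (2 * ν) * (2 * ν)))) * T.S := mul_le_mul_of_nonneg_right hR hSr.le
      _ = (‖emPoch s (2 * ν + 1)‖ * T.S) * ((33 / 10 : ℝ) * (25 / 157) ^ (2 * ν + 1)) *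
            (1 / ((T.N : ℝ) ^ (2 * ν) * (2 * ν))) := by ring
      _ ≤ (U : ℝ) * ((33 / 10 : ℝ) * (25 / 157) ^ (2 * ν + 1)) * (1 / ((T.N : ℝ) ^ (2 * ν) * (2 * ν))) :=
          mul_le_mul_of_nonneg_right (mul_le_mul_of_nonneg_right hPS hC) hD
  refine h1.trans (le_of_eq ?_)
  rw [div_pow]
  field_simp

/-- **Soundness of the ball evaluator.** [folklore] -/
theorem mem_zetaBall (hT : T.Valid) (hs : MC.mem T.S s sB) (hs1 : s ≠ 1) {Z : MC}
    (h : zetaBall T P sB = some Z) : MC.mem T.S (riemannZeta s) Z := by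
  unfold zetaBall at h
  split_ifs at h with hc
  obtain ⟨hlo, hS2, hν⟩ := hc
  split at h
  · simp at h
  · rename_i A hA
    split at h
    · rename_i M Tm hM hTm
      simp only [Option.some.injEq] at h
      subst h
      have hσ : 0 < s.re := MI.pos_of_lo_pos hs.1 hlo
      have hN1 : 1 ≤ T.N := le_trans (by norm_num) hT.two_le_N
      obtain ⟨-, hApow⟩ := powTableBall_spec hT hS2 hs T.N le_rfl hA
      have hmain := mem_mainBall hT hS2 hs hApow hM
      have hterms := mem_termsBall hT hS2 hs hν (hApow T.N hN1 le_rfl) hTm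
      have hsum := FBC.mem_toMC (FBC.mem_add hmain hterms)
      rw [← hS2] at hsum
      rw [riemannZeta_eq_eulerMaclaurin_of_re_pos hN1 hσ hs1 P.nuT]
      apply MC.mem_widen hsum
      rw [show emMainZero T.N s + ∑ k ∈ Finset.Icc 1 P.nuT, emTerm T.N s k + emRemHigher T.N P.nuT s -
        (emMainZero T.N s + ∑ j ∈ Finset.Icc 1 P.nuT, emTerm T.N s j) = emRemHigher T.N P.nuT s by ring]
      exact norm_emRem_mul_le_remRadiusN hT hs hσ (by omega)
    · simp at h

end Soundness

end Literature.NumberTheory.LFunctions.ZetaNumerics
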